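import Mathlib
import Literature.Analysis.FluidPDE.Tao2016AveragedNS.RestartedCascadeFlows
import HarnessLib

/-!
# `GappedFrontRobust`, tools for the (step) clause: GEOMETRIC TAIL SUMS — slack weights bounded
  uniformly in the number of past epochs, and the start energy above a tail shell (helper for item
  stmt-NavierStokesRegularity-20423 and its announced restatement K_B₂ over `GapData₂`)

HONEST FRAMING: elementary real-number bookkeeping for the tail zone of a robust front step, in the cell
vocabulary `TaoCascade.slackWeight` / `ballDesc`-type hypotheses of the tree module
`RestartedCascadeFlows` (Tao 2016 §6.2 Prop. 6.3 (ix): super-geometric control ahead of the front).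
Nothing is asserted about any table or flow; nothing here concerns the Navier–Stokes equations.

* `geom_partial_sum_le` — `g ≥ 0`, `g (K+k+1) ≤ ρ g (K+k)` (`0 ≤ ρ < 1`) ⇒ every partial sum
  `∑_{k<L} g (K+k) ≤ g K / (1 − ρ)`.
* `slackWeight_le_of_env_ratio` — if beyond the shell `k` the envelope contracts against the epoch
  factor, `(1+ε₀)^{5/2+θ} env (j+1) ≤ ρ env j` for `j ≥ k+1` (`0 ≤ ρ < 1`, `env ≥ 0`), then
  `slackWeight ε₀ θ c env L k ≤ c (1+ε₀)^{2k} (1+ε₀)^{5/2+θ} env (k+1) / (1 − ρ)` for EVERY `L`: in the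
  tail the admissible slack `η · slackWeight L k` of `RobustStep` is bounded independently of the
  number `L` of past epochs (the tail envelope `K r²/w(j-1)²` of the K_B₂ architecture contracts
  super-geometrically by (T1)).
* `tail_start_energy_le` — under (T1) `2 (1+ε₀)^k w k ≤ w (k+1)` and (T2) `4 w k |z_k| ≤ r` from `k₁`
  on, a ball start `w k |S₀_{i,k} − z_{i,k}| ≤ r` with start energies `F₀ ≤ ½ S₀² + B₀` and tail slack
  `B₀_{i,k} ≤ β (1+ε₀)^{2k} r² / (w k)²` has, above every shell `K ≥ max k₁ 1`, start energy partial
  sums `∑_{k<L} ∑_i F₀_{i,K+k} ≤ (4/3) m (25/32 + β (1+ε₀)^{2K}) r² / (w K)²` — the `E K` of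
  `pseudoFlowOn_tail_induction`.
-/

noncomputable section

-- the sub-problem namespace `Summit.NavierStokesRegularity.NavierStokesRegularity` repeats the summit name by design (D-0017)
set_option linter.dupNamespace false

namespace Summit.NavierStokesRegularity.NavierStokesRegularity.Theorems

open Set Literature.Analysis.FluidPDE Literature.Analysis.FluidPDE.TaoCascade

namespace GappedFrontRobust

/-! ### Geometric partial sums -/

/-- **Geometric partial sums**: if `g (K+k) ≥ 0` and `g (K+k+1) ≤ ρ g (K+k)` for all `k : ℕ`
(`0 ≤ ρ < 1`), then `∑_{k<L} g (K+k) ≤ g K / (1 − ρ)` for every `L`. [folklore] -/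
theorem geom_partial_sum_le {g : ℤ → ℝ} {K : ℤ} {ρ : ℝ} (hρ0 : 0 ≤ ρ) (hρ1 : ρ < 1)
    (hg0 : ∀ k : ℕ, 0 ≤ g (K + k)) (hstep : ∀ k : ℕ, g (K + k + 1) ≤ ρ * g (K + k)) (L : ℕ) :
    ∑ k ∈ Finset.range L, g (K + k) ≤ g K / (1 - ρ) := by
  -- g (K+k) ≤ ρ^k g K
  have hpow : ∀ k : ℕ, g (K + k) ≤ ρ ^ k * g K := by
    intro k
    induction k with
    | zero => simp
    | succ k ih =>
      have h1 := hstep k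
      have h2 : (K + (k : ℕ) + 1 : ℤ) = K + ((k + 1 : ℕ) : ℤ) := by push_cast; ring
      rw [h2] at h1
      calc g (K + ((k + 1 : ℕ) : ℤ)) ≤ ρ * g (K + k) := h1
        _ ≤ ρ * (ρ ^ k * g K) := mul_le_mul_of_nonneg_left ih hρ0
        _ = ρ ^ (k + 1) * g K := by ring
  have hgK : 0 ≤ g K := by simpa using hg0 0
  calc ∑ k ∈ Finset.range L, g (K + k) ≤ ∑ k ∈ Finset.range L, ρ ^ k * g K :=
        Finset.sum_le_sum fun k _ => hpow k
    _ = (∑ k ∈ Finset.range L, ρ ^ k) * g K := by rw [Finset.sum_mul]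
    _ ≤ (1 / (1 - ρ)) * g K := by
        refine mul_le_mul_of_nonneg_right ?_ hgK
        have h := geom_sum_Ico_le_of_lt_one (m := 0) (n := L) hρ0 hρ1
        rw [pow_zero] at h
        rwa [Finset.range_eq_Ico]
    _ = g K / (1 - ρ) := by ring

/-! ### Slack weights in the tail: bounded uniformly in the number of past epochs -/

/-- **Slack weight under a contracting envelope.** If `env ≥ 0` and the envelope contracts against the
epoch factor beyond the shell `k`, `(1+ε₀)^{5/2+θ} env (j+1) ≤ ρ env j` for all `j ≥ k+1`
(`0 ≤ ρ < 1`, `ε₀ > -1`, `c ≥ 0`), then for EVERY number `L` of past epochs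
`slackWeight ε₀ θ c env L k ≤ c (1+ε₀)^{2k} ((1+ε₀)^{5/2+θ} env (k+1)) / (1 − ρ)`.
[cite: Tao2016AveragedNS, §6.4 Lemma 6.7 (cumulative energy bound); cell vocabulary] -/
theorem slackWeight_le_of_env_ratio {ε₀ θ c ρ : ℝ} {env : ℤ → ℝ} (hε : 0 < 1 + ε₀) (hc : 0 ≤ c)
    (hρ0 : 0 ≤ ρ) (hρ1 : ρ < 1) (henv : ∀ j, 0 ≤ env j) (k : ℤ)
    (hratio : ∀ j : ℤ, k + 1 ≤ j → (1 + ε₀) ^ (5 / 2 + θ) * env (j + 1) ≤ ρ * env j) (L : ℕ) :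
    slackWeight ε₀ θ c env L k ≤
      c * (1 + ε₀) ^ ((2 : ℝ) * k) * (((1 + ε₀) ^ (5 / 2 + θ) * env (k + 1)) / (1 - ρ)) := by
  unfold slackWeight
  refine mul_le_mul_of_nonneg_left ?_ (mul_nonneg hc (Real.rpow_pos_of_pos hε _).le)
  -- the summand as a function of d, shifted to start at d = 1
  set g : ℤ → ℝ := fun d => (1 + ε₀) ^ ((5 / 2 + θ) * ((d : ℝ) + 1)) * env (k + (d + 1)) with hg
  have hg0 : ∀ n : ℕ, 0 ≤ g (0 + n) := fun n =>
    mul_nonneg (Real.rpow_pos_of_pos hε _).le (henv _)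
  have hgstep : ∀ n : ℕ, g (0 + n + 1) ≤ ρ * g (0 + n) := by
    intro n
    simp only [hg, zero_add]
    have hj : k + 1 ≤ k + ((n : ℤ) + 1) := by
      have : (0 : ℤ) ≤ n := Int.natCast_nonneg n
      linarith
    have hr := hratio (k + ((n : ℤ) + 1)) hj
    have hpow : (1 + ε₀) ^ ((5 / 2 + θ) * (((n + 1 : ℤ) : ℝ) + 1)) =
        (1 + ε₀) ^ ((5 / 2 + θ) * ((n : ℝ) + 1)) * (1 + ε₀) ^ (5 / 2 + θ) := by
      rw [← Real.rpow_add hε]; push_cast; ring_nf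
    have heq : k + ((n + 1 : ℤ) + 1) = k + ((n : ℤ) + 1) + 1 := by ring
    rw [hpow, heq, mul_assoc]
    have h0 : 0 ≤ (1 + ε₀) ^ ((5 / 2 + θ) * ((n : ℝ) + 1)) := (Real.rpow_pos_of_pos hε _).le
    calc (1 + ε₀) ^ ((5 / 2 + θ) * ((n : ℝ) + 1)) * ((1 + ε₀) ^ (5 / 2 + θ) * env (k + ((n : ℤ) + 1) + 1))
        ≤ (1 + ε₀) ^ ((5 / 2 + θ) * ((n : ℝ) + 1)) * (ρ * env (k + ((n : ℤ) + 1))) :=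
          mul_le_mul_of_nonneg_left hr h0
      _ = ρ * ((1 + ε₀) ^ ((5 / 2 + θ) * ((n : ℝ) + 1)) * env (k + ((n : ℤ) + 1))) := by ring
  have hsum := geom_partial_sum_le (K := 0) hρ0 hρ1 hg0 hgstep L
  -- re-index the slack sum: d ∈ Icc 1 L  ↔  d = n + 1, n ∈ range L
  have hreindex : ∑ d ∈ Finset.Icc 1 L, (1 + ε₀) ^ ((5 / 2 + θ) * (d : ℝ)) * env (k + d) =
      ∑ n ∈ Finset.range L, g (0 + n) := by
    rw [Finset.range_eq_Ico]
    have : Finset.Icc 1 L = Finset.Ico (0 + 1) (L + 1) := by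
      ext d; simp [Finset.mem_Icc, Finset.mem_Ico]
    rw [this, ← Finset.sum_Ico_add' (fun d : ℕ => (1 + ε₀) ^ ((5 / 2 + θ) * (d : ℝ)) * env (k + d)) 0 L 1]
    refine Finset.sum_congr rfl fun n _ => ?_
    simp only [hg, zero_add]
    push_cast
    ring_nf
  rw [hreindex]
  refine hsum.trans (le_of_eq ?_)
  simp only [hg, zero_add, Int.cast_zero]
  ring_nf

/-! ### The start energy above a tail shell -/

/-- **Start energy above a tail shell.** Let `ε₀ ≥ 0`, `β ≥ 0`, weights `w > 0` with (T1)
`2 (1+ε₀)^k w k ≤ w (k+1)` and reference amplitudes with (T2) `4 w k |z_{i,k}| ≤ r` for `k ≥ k₁`, a ball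
start `w k |S₀_{i,k} − z_{i,k}| ≤ r` (all `k`), start energies `F₀ ≤ ½ S₀² + B₀` and tail slack
`B₀_{i,k} ≤ β (1+ε₀)^{2k} r² / (w k)²` for `k ≥ k₁`. Then above every shell `K ≥ max k₁ 1` the start
energy partial sums obey `∑_{k<L} ∑_i F₀_{i,K+k} ≤ (4/3) m (25/32 + β (1+ε₀)^{2K}) r² / (w K)²`
(`|S₀| ≤ 5r/(4w)`; consecutive terms contract by `(1+ε₀)²/(4 (1+ε₀)^{2k}) ≤ 1/4`).
[cite: Tao2016AveragedNS, §6.2 Prop. 6.3 (ix) (energy estimates ahead of the front); cell vocabulary] -/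
theorem tail_start_energy_le {ε₀ r β : ℝ} {m : ℕ} {w : ℤ → ℝ} {z S₀ F₀ B₀ : Fin m → ℤ → ℝ}
    {k₁ K : ℤ} (hε : 0 ≤ ε₀) (hβ : 0 ≤ β) (hw : ∀ k, 0 < w k)
    (hT1 : ∀ k : ℤ, k₁ ≤ k → 2 * (1 + ε₀) ^ (k : ℝ) * w k ≤ w (k + 1))
    (hT2 : ∀ k : ℤ, k₁ ≤ k → ∀ i, 4 * (w k * |z i k|) ≤ r)
    (hball : ∀ i k, w k * |S₀ i k - z i k| ≤ r)
    (hF₀ : ∀ i k, F₀ i k ≤ (1 / 2) * S₀ i k ^ 2 + B₀ i k)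
    (hB₀ : ∀ i k, k₁ ≤ k → B₀ i k ≤ β * (1 + ε₀) ^ ((2 : ℝ) * k) * r ^ 2 / w k ^ 2)
    (hK : k₁ ≤ K) (hK1 : 1 ≤ K) (L : ℕ) :
    ∑ k ∈ Finset.range L, ∑ i, F₀ i (K + k) ≤
      4 / 3 * m * ((25 / 32 + β * (1 + ε₀) ^ ((2 : ℝ) * K)) * r ^ 2 / w K ^ 2) := by
  have hq : 0 < 1 + ε₀ := by linarith
  have hq1 : 1 ≤ 1 + ε₀ := by linarith
  -- the per-shell bound f
  set f : ℤ → ℝ := fun k => (25 / 32 + β * (1 + ε₀) ^ ((2 : ℝ) * k)) * r ^ 2 / w k ^ 2 with hf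
  have hf0 : ∀ k, 0 ≤ f k := fun k => by
    have := hw k; have := Real.rpow_pos_of_pos hq ((2 : ℝ) * k); positivity
  -- per mode: F₀ i k ≤ f k for k ≥ k₁
  have hmode : ∀ (i : Fin m) (k : ℤ), k₁ ≤ k → F₀ i k ≤ f k := by
    intro i k hk
    have hwk := hw k
    have h1 : |S₀ i k| ≤ 5 / 4 * (r / w k) := by
      have hb := hball i k
      have ht := hT2 k hk i
      have hb' : |S₀ i k - z i k| ≤ r / w k := by
        rw [le_div_iff₀ hwk]; linarith [mul_comm (w k) |S₀ i k - z i k|]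
      have ht' : |z i k| ≤ r / (4 * w k) := by
        rw [le_div_iff₀ (by positivity)]; linarith [mul_comm (w k) |z i k|]
      have htri : |S₀ i k| ≤ |S₀ i k - z i k| + |z i k| := by
        have := abs_add_le (S₀ i k - z i k) (z i k); simpa using this
      have : r / (4 * w k) = 1 / 4 * (r / w k) := by field_simp
      linarith
    have h2 : (1 / 2) * S₀ i k ^ 2 ≤ 25 / 32 * (r ^ 2 / w k ^ 2) := by
      have hsq : S₀ i k ^ 2 ≤ (5 / 4 * (r / w k)) ^ 2 := by
        have := sq_le_sq' (by linarith [abs_nonneg (S₀ i k), neg_abs_le (S₀ i k)]) (le_of_abs_le h1)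
        simpa using this
      have heq : (5 / 4 * (r / w k)) ^ 2 = 25 / 16 * (r ^ 2 / w k ^ 2) := by ring
      rw [heq] at hsq
      linarith
    have h3 := hB₀ i k hk
    calc F₀ i k ≤ (1 / 2) * S₀ i k ^ 2 + B₀ i k := hF₀ i k
      _ ≤ 25 / 32 * (r ^ 2 / w k ^ 2) + β * (1 + ε₀) ^ ((2 : ℝ) * k) * r ^ 2 / w k ^ 2 := by
          linarith
      _ = f k := by simp only [hf]; ring
  -- consecutive ratio ≤ 1/4 from (T1), for k ≥ max k₁ 1
  have hratio : ∀ n : ℕ, f (K + n + 1) ≤ 1 / 4 * f (K + n) := by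
    intro n
    set k : ℤ := K + n with hkdef
    have hk1 : k₁ ≤ k := by rw [hkdef]; have : (0 : ℤ) ≤ n := Int.natCast_nonneg n; linarith
    have hk2 : (1 : ℝ) ≤ k := by
      have : (1 : ℤ) ≤ k := by rw [hkdef]; have : (0 : ℤ) ≤ n := Int.natCast_nonneg n; linarith
      exact_mod_cast this
    have hwk := hw k
    have hwk1 := hw (k + 1)
    have hT := hT1 k hk1
    -- (1+ε₀)^{2(k+1)} = (1+ε₀)^{2k} (1+ε₀)^2 and (1+ε₀)^2 ≤ (1+ε₀)^{2k}
    have hpow : (1 + ε₀) ^ ((2 : ℝ) * ((k + 1 : ℤ) : ℝ)) =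
        (1 + ε₀) ^ ((2 : ℝ) * k) * (1 + ε₀) ^ (2 : ℝ) := by
      rw [← Real.rpow_add hq]; push_cast; ring_nf
    have hqk : (1 + ε₀) ^ (2 : ℝ) ≤ (1 + ε₀) ^ ((2 : ℝ) * k) :=
      Real.rpow_le_rpow_of_exponent_le hq1 (by nlinarith)
    -- numerator: 25/32 + β q^{2k} q² ≤ q^{2} (25/32 + β q^{2k}) ... we only need the weaker chain below
    have hnum : 25 / 32 + β * (1 + ε₀) ^ ((2 : ℝ) * ((k + 1 : ℤ) : ℝ)) ≤
        (1 + ε₀) ^ (2 : ℝ) * (25 / 32 + β * (1 + ε₀) ^ ((2 : ℝ) * k)) := by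
      rw [hpow]
      have h1 : (1 : ℝ) ≤ (1 + ε₀) ^ (2 : ℝ) := Real.one_le_rpow hq1 (by norm_num)
      have h2 : 0 ≤ β * (1 + ε₀) ^ ((2 : ℝ) * k) := mul_nonneg hβ (Real.rpow_pos_of_pos hq _).le
      nlinarith
    -- denominator: w (k+1)² ≥ 4 (1+ε₀)^{2k} w k²
    have hden : 4 * ((1 + ε₀) ^ (k : ℝ)) ^ 2 * w k ^ 2 ≤ w (k + 1) ^ 2 := by
      have h0 : 0 ≤ 2 * (1 + ε₀) ^ (k : ℝ) * w k := by
        have := Real.rpow_pos_of_pos hq (k : ℝ); positivity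
      have := pow_le_pow_left₀ h0 hT 2
      nlinarith
    have hqk' : ((1 + ε₀) ^ (k : ℝ)) ^ 2 = (1 + ε₀) ^ ((2 : ℝ) * k) := by
      rw [← Real.rpow_mul_natCast hq.le]; push_cast; ring_nf
    -- assemble
    have hkeq : K + (n : ℤ) + 1 = k + 1 := by rw [hkdef]
    rw [hkeq]
    simp only [hf]
    rw [div_le_iff₀ (pow_pos hwk1 2)]
    have hA : 0 ≤ 25 / 32 + β * (1 + ε₀) ^ ((2 : ℝ) * k) :=
      add_nonneg (by norm_num) (mul_nonneg hβ (Real.rpow_pos_of_pos hq _).le)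
    have hr2 : 0 ≤ r ^ 2 := sq_nonneg r
    -- target: (25/32 + β q^{2(k+1)}) r² ≤ 1/4 · ((25/32 + β q^{2k}) r²/w k²) · w(k+1)²
    have key : (25 / 32 + β * (1 + ε₀) ^ ((2 : ℝ) * ((k + 1 : ℤ) : ℝ))) * r ^ 2 * w k ^ 2 ≤
        1 / 4 * ((25 / 32 + β * (1 + ε₀) ^ ((2 : ℝ) * k)) * r ^ 2) * w (k + 1) ^ 2 := by
      calc (25 / 32 + β * (1 + ε₀) ^ ((2 : ℝ) * ((k + 1 : ℤ) : ℝ))) * r ^ 2 * w k ^ 2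
          ≤ ((1 + ε₀) ^ (2 : ℝ) * (25 / 32 + β * (1 + ε₀) ^ ((2 : ℝ) * k))) * r ^ 2 * w k ^ 2 := by
            gcongr
        _ ≤ ((1 + ε₀) ^ ((2 : ℝ) * k) * (25 / 32 + β * (1 + ε₀) ^ ((2 : ℝ) * k))) * r ^ 2 *
              w k ^ 2 := by gcongr
        _ = 1 / 4 * ((25 / 32 + β * (1 + ε₀) ^ ((2 : ℝ) * k)) * r ^ 2) *
              (4 * ((1 + ε₀) ^ (k : ℝ)) ^ 2 * w k ^ 2) := by rw [hqk']; ring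
        _ ≤ 1 / 4 * ((25 / 32 + β * (1 + ε₀) ^ ((2 : ℝ) * k)) * r ^ 2) * w (k + 1) ^ 2 := by
            gcongr
    have hwk2 : 0 < w k ^ 2 := pow_pos hwk 2
    calc (25 / 32 + β * (1 + ε₀) ^ ((2 : ℝ) * ((k + 1 : ℤ) : ℝ))) * r ^ 2
        = (25 / 32 + β * (1 + ε₀) ^ ((2 : ℝ) * ((k + 1 : ℤ) : ℝ))) * r ^ 2 * w k ^ 2 / w k ^ 2 := by
          field_simp
      _ ≤ 1 / 4 * ((25 / 32 + β * (1 + ε₀) ^ ((2 : ℝ) * k)) * r ^ 2) * w (k + 1) ^ 2 / w k ^ 2 := by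
          gcongr
      _ = 1 / 4 * ((25 / 32 + β * (1 + ε₀) ^ ((2 : ℝ) * k)) * r ^ 2 / w k ^ 2) * w (k + 1) ^ 2 := by
          ring
  -- sum over modes, then the geometric sum
  have hm : ∀ k : ℕ, ∑ i, F₀ i (K + k) ≤ m * f (K + k) := by
    intro k
    have hk : k₁ ≤ K + k := by have : (0 : ℤ) ≤ k := Int.natCast_nonneg k; linarith
    calc ∑ i, F₀ i (K + k) ≤ ∑ _i : Fin m, f (K + k) := Finset.sum_le_sum fun i _ => hmode i _ hk
      _ = m * f (K + k) := by simp
  have hgeo := geom_partial_sum_le (g := fun k => m * f k) (K := K) (ρ := 1 / 4) (by norm_num)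
    (by norm_num) (fun k => mul_nonneg (Nat.cast_nonneg m) (hf0 _))
    (fun k => by
      have := hratio k
      have hm0 : (0 : ℝ) ≤ m := Nat.cast_nonneg m
      nlinarith) L
  calc ∑ k ∈ Finset.range L, ∑ i, F₀ i (K + k) ≤ ∑ k ∈ Finset.range L, m * f (K + k) :=
        Finset.sum_le_sum fun k _ => hm k
    _ ≤ m * f K / (1 - 1 / 4) := hgeo
    _ = 4 / 3 * m * ((25 / 32 + β * (1 + ε₀) ^ ((2 : ℝ) * K)) * r ^ 2 / w K ^ 2) := by
        simp only [hf]; ring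

end GappedFrontRobust

end Summit.NavierStokesRegularity.NavierStokesRegularity.Theorems

end
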